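import Summits.FinalStateConjecture.FinalStateConjecture.Theorems.PhotonSphereChannelsWindowedShellChannelsStubCompactRate
import Summits.FinalStateConjecture.FinalStateConjecture.Theorems.PhotonSphereChannelsWindowedShellChannelsStubLostPSD
import Summits.FinalStateConjecture.FinalStateConjecture.Theorems.PhotonSphereChannelsWindowedShellChannelsStubDyadicSplit
import Summits.FinalStateConjecture.FinalStateConjecture.Theorems.PhotonSphereChannelsWindowedShellChannelsStubNearFarAdditivity
import Summits.FinalStateConjecture.FinalStateConjecture.Theorems.PhotonSphereChannelsWindowedShellChannelsStubNearHalfShare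
import Summits.FinalStateConjecture.FinalStateConjecture.Theorems.PhotonSphereChannelsWindowedShellChannelsStubFarHalfShare
import Summits.FinalStateConjecture.FinalStateConjecture.Theorems.PhotonSphereChannelsWindowedShellChannelsStubParity

/-!
# Crux `WindowedShellChannels` (stmt-FinalStateConjecture-14085), line `Sketch` — the per-mode residue
# `coreMode σ` as a THEOREM (composition of the six landed pieces S1–S4, P2n, P2f)

The per-mode residue of the line (caught-form): for every shell half-width `ρ > 0` and every mode
`s ≤ 2`, `s ≤ ℓ` there are a lag `h ≥ 0` and `c > 0` such that every finite-energy parity-`σ`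
unit-mass Regge–Wheeler solution along the centred tortoise line whose Cauchy data vanish on
`{|x| ≤ ρ}` radiates at least `c·E` ahead of the lagged forward cone:
`c·E ≤ channelEnergy V 0 (ρ − h) ψ atTop` (`stub_coreMode`).

The COMPOSITION is the one proved by the line lead (seat prover-line-stmt-FinalStateConjecture-14085-c2-0,
skeleton `Cruxes/WindowedShellChannels/Lines/Sketch.lean` v5, theorem `coreMode`), reproduced here verbatim
now that all six pieces are landed theorems: split `ψ = ψc + (ψn + ψf)` (S3 `stub_dyadicSplit`,
`δ = c₂/4`), lose at most `(1+η⁻¹)·LOST(ψc) + (1+η)·LOST(ψn+ψf)` (S2 `stub_lostPSD`, `η = c₂/4`),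
`LOST(ψc) ≤ (C₁R₁/B)·4E` (S1 `stub_compactRate`), `LOST(ψn+ψf) ≤ (1−c₂)(1+δ)E` (S4
`stub_nearFarAdditivity` + P2n `stub_nearHalfShare` + P2f `stub_farHalfShare` + aperture monotonicity),
with `B` so large that `4(1+η⁻¹)C₁R₁/B ≤ c₂/8`; lag `h = ρ + B`, constant `c₂/4`,
`c₂ = min(c_near, c_far, 1)`.  No definitions. [new]
-/

noncomputable section

set_option linter.dupNamespace false

namespace Summit.FinalStateConjecture.FinalStateConjecture.Theorems.WindowedShellChannelsSketch

open Literature.Geometry.Lorentzian Literature.Geometry.Lorentzian.ReggeWheeler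
open Summit.FinalStateConjecture.FinalStateConjecture.Theorems.WindowedShellChannelsStubs
open Filter Set MeasureTheory
open scoped ENNReal Topology

/-- **The per-mode residue `coreMode σ` of line `Sketch` (caught-form), composed from the six landed
pieces** (composition by lead c2, skeleton v5). See the module docstring. [new] -/
theorem stub_coreMode (σ : ℝ) : ∀ ρ : ℝ, 0 < ρ → ∀ (s ℓ : ℕ), s ≤ 2 → s ≤ ℓ → ∃ h : ℝ, 0 ≤ h ∧ ∃ c : ℝ, 0 < c ∧
    ∀ ψ : ℝ → ℝ → ℝ,
        IsRWSolution 1 s ℓ (tortoiseRadius one_pos 0) ψ → (∀ t x, ψ (-t) x = σ * ψ t x) →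
        CauchyDataSupportedOn ψ {x : ℝ | ρ < |x|} →
        totalEnergy (linePotential 1 s ℓ (tortoiseRadius one_pos 0)) ψ 0 ≠ ⊤ →
          ENNReal.ofReal c * totalEnergy (linePotential 1 s ℓ (tortoiseRadius one_pos 0)) ψ 0 ≤
            channelEnergy (linePotential 1 s ℓ (tortoiseRadius one_pos 0)) 0 (ρ - h) ψ atTop := by
  intro ρ hρ s ℓ hs hsℓ
  classical
  -- the pieces of this mode
  obtain ⟨C₁, hC₁, HS1⟩ := stub_compactRate s ℓ hs hsℓ
  have HS2 := stub_lostPSD s ℓ hsℓ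
  have HS4 := stub_nearFarAdditivity s ℓ hsℓ
  obtain ⟨cn, hcn, Rn, hRn, Bn, hBn, Hn⟩ := stub_nearHalfShare σ s ℓ hs hsℓ
  obtain ⟨cf, hcf, Rf, hRf, Bf, hBf, Hf⟩ := stub_farHalfShare σ s ℓ hs hsℓ
  -- parameters
  set c₂ : ℝ := min (min cn cf) 1 with hc₂
  have hc₂0 : 0 < c₂ := lt_min (lt_min hcn hcf) one_pos
  have hc₂n : c₂ ≤ cn := (min_le_left _ _).trans (min_le_left _ _)
  have hc₂f : c₂ ≤ cf := (min_le_left _ _).trans (min_le_right _ _)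
  have hc₂1 : c₂ ≤ 1 := min_le_right _ _
  set Bs : ℝ := max Bn Bf with hBs
  have hBs0 : 0 ≤ Bs := hBn.trans (le_max_left _ _)
  have hBnBs : Bn ≤ Bs := le_max_left _ _
  have hBfBs : Bf ≤ Bs := le_max_right _ _
  set R₀ : ℝ := max (max Rn Rf) (max Bs (max ρ 1)) with hR₀
  have hRnR₀ : Rn ≤ R₀ := (le_max_left _ _).trans (le_max_left _ _)
  have hRfR₀ : Rf ≤ R₀ := (le_max_right _ _).trans (le_max_left _ _)
  have hBsR₀ : Bs ≤ R₀ := (le_max_left _ _).trans (le_max_right _ _)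
  have hρR₀ : ρ ≤ R₀ := ((le_max_left _ _).trans (le_max_right _ _)).trans (le_max_right _ _)
  have h1R₀ : 1 ≤ R₀ := ((le_max_right _ _).trans (le_max_right _ _)).trans (le_max_right _ _)
  set δ : ℝ := c₂ / 4 with hδ
  have hδ0 : 0 < δ := by positivity
  obtain ⟨R₁, hR₀R₁, HS3⟩ := stub_dyadicSplit σ s ℓ hsℓ ρ hρ δ hδ0 R₀ hρR₀
  have h1R₁ : 1 ≤ R₁ := h1R₀.trans hR₀R₁
  set η : ℝ := c₂ / 4 with hη
  have hη0 : 0 < η := by positivity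
  set A : ℝ := 1 + η⁻¹ with hA
  have hA0 : 0 ≤ A := by positivity
  set X : ℝ := A * C₁ * R₁ with hX
  have hX0 : 0 ≤ X := by positivity
  set B : ℝ := max Bs (32 * X / c₂ + 1) with hB
  have hB1 : 32 * X / c₂ + 1 ≤ B := le_max_right _ _
  have hB0 : 0 < B := lt_of_lt_of_le (by positivity) hB1
  have hBsB : Bs ≤ B := le_max_left _ _
  have hkey : A * (C₁ * R₁ / B) * 4 ≤ c₂ / 8 := by
    have h32 : 32 * X ≤ c₂ * B := by
      have h' : 32 * X / c₂ ≤ B := by linarith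
      have h'' := (div_le_iff₀ hc₂0).1 h'
      linarith [mul_comm B c₂]
    rw [show A * (C₁ * R₁ / B) * 4 = 4 * X / B by rw [hX]; ring]
    rw [div_le_iff₀ hB0]
    linarith
  have hpoly : (1 + η) * (1 + δ) * (1 - c₂) ≤ 1 - c₂ / 2 := by
    rw [hη, hδ]; nlinarith [sq_nonneg c₂, hc₂0.le, mul_nonneg (mul_nonneg hc₂0.le hc₂0.le) hc₂0.le]
  refine ⟨ρ + B, by positivity, c₂ / 4, by positivity, ?_⟩
  intro ψ hψ hpar hsupp hE
  obtain ⟨ψc, ψn, ψf, hψc, hψn, hψf, hsum, hpc, hpn, hpf, hsc, hsn, hsf, hEc, hEnf⟩ :=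
    HS3 ψ hψ hpar hsupp hE
  have hr := isTortoiseRadius_tortoiseRadius one_pos (0 : ℝ)
  -- the outer sum and the full sum
  have hψnf : IsRWSolution 1 s ℓ (tortoiseRadius one_pos 0) (fun t x => ψn t x + ψf t x) :=
    Duality.isSolution_add hψn hψf
  have hψeq : (fun t x => ψc t x + (ψn t x + ψf t x)) = ψ := by
    funext t x
    rw [hsum t x]
  -- instantiate the pieces BEFORE abstracting the potential
  have hsn' : CauchyDataSupportedOn ψn (Iio (-Rn)) := fun x hx =>
    hsn x (fun h => hx (mem_Iio.2 (lt_of_lt_of_le (mem_Iio.1 h) (by linarith))))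
  have hsf' : CauchyDataSupportedOn ψf (Ioi Rf) := fun x hx =>
    hsf x (fun h => hx (mem_Ioi.2 (lt_of_le_of_lt hRfR₀ (mem_Ioi.1 h))))
  obtain ⟨K4a, K4b⟩ := HS4 R₀ Bs hBs0 hBsR₀ ψn ψf hψn hψf hsn hsf
  have K2 := HS2 ψc (fun t x => ψn t x + ψf t x) hψc hψnf
  have K1 := HS1 R₁ h1R₁ ψc hψc hsc
  have Kn₀ := Hn ψn hψn hpn hsn'
  have Kf₀ := Hf ψf hψf hpf hsf'
  generalize hVdef : linePotential 1 s ℓ (tortoiseRadius one_pos 0) = V at *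
  have hVd : Differentiable ℝ V := hVdef ▸ RW.differentiable_linePotential hr s ℓ
  have hV0 : ∀ x, 0 ≤ V x := fun x => hVdef ▸ (RW.linePotential_pos hr hsℓ x).le
  have hψ' : IsSolution V ψ := hVdef ▸ hψ
  have hψc' : IsSolution V ψc := hVdef ▸ hψc
  have hψnf' : IsSolution V (fun t x => ψn t x + ψf t x) := hVdef ▸ hψnf
  -- channel energies never exceed the (conserved) energy
  have hcauE : ∀ (φ : ℝ → ℝ → ℝ), IsSolution V φ → ∀ a : ℝ,
      channelEnergy V 0 a φ atTop ≤ totalEnergy V φ 0 := by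
    intro φ hφ a
    unfold channelEnergy
    calc liminf (exteriorEnergy V 0 a φ) atTop ≤ liminf (fun t => totalEnergy V φ t) atTop :=
          Filter.liminf_le_liminf (Eventually.of_forall fun t => exteriorEnergy_le_totalEnergy V 0 a φ t)
      _ = totalEnergy V φ 0 := by
          simp_rw [RW.totalEnergy_eq_totalEnergy hVd hV0 hφ _ 0]
          exact Filter.liminf_const _
  -- names
  set E := totalEnergy V ψ 0 with hEdef
  set Ec := totalEnergy V ψc 0 with hEcdef
  set En := totalEnergy V ψn 0 with hEndef
  set Ef := totalEnergy V ψf 0 with hEfdef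
  set k := channelEnergy V 0 (-B) ψ atTop with hkdef
  set kc := channelEnergy V 0 (-B) ψc atTop with hkcdef
  set knf := channelEnergy V 0 (-B) (fun t x => ψn t x + ψf t x) atTop with hknfdef
  -- finiteness
  have hEt : E ≠ ⊤ := hE
  have hEct : Ec ≠ ⊤ := ne_top_of_le_ne_top (ENNReal.mul_ne_top ENNReal.ofReal_ne_top hEt) hEc
  have hEnft : En + Ef ≠ ⊤ := ne_top_of_le_ne_top (ENNReal.mul_ne_top ENNReal.ofReal_ne_top hEt) hEnf
  have hEnt : En ≠ ⊤ := ne_top_of_le_ne_top hEnft le_self_add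
  have hEft : Ef ≠ ⊤ := ne_top_of_le_ne_top hEnft le_add_self
  have hkc_le : kc ≤ Ec := hcauE ψc hψc' (-B)
  have hknf_le : knf ≤ En + Ef := by
    have h := hcauE _ hψnf' (-B)
    rwa [K4b] at h
  have hk_le : k ≤ E := hcauE ψ hψ' (-B)
  have hkct : kc ≠ ⊤ := ne_top_of_le_ne_top hEct hkc_le
  have hknft : knf ≠ ⊤ := ne_top_of_le_ne_top hEnft hknf_le
  have hkt : k ≠ ⊤ := ne_top_of_le_ne_top hEt hk_le
  -- (S2) at aperture `−B`, (S1) for the compact piece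
  have hEnft' : totalEnergy V (fun t x => ψn t x + ψf t x) 0 ≠ ⊤ := by rw [K4b]; exact hEnft
  have K2' := K2 hEct hEnft' (-B) η hη0
  beta_reduce at K2'
  rw [hψeq, K4b] at K2'
  have K1' := K1 hEct B hB0
  -- the outer pieces: near and far half-shares, additivity, aperture monotonicity
  have Kn : ENNReal.ofReal c₂ * En ≤ channelEnergy V 0 (-Bs) ψn atTop := by
    calc ENNReal.ofReal c₂ * En ≤ ENNReal.ofReal cn * En := mul_le_mul' (ENNReal.ofReal_le_ofReal hc₂n) le_rfl
      _ ≤ channelEnergy V 0 (-Bn) ψn atTop := Kn₀ hEnt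
      _ ≤ channelEnergy V 0 (-Bs) ψn atTop := Parity.channelEnergy_mono_aperture V 0 (by linarith) ψn atTop
  have Kf : ENNReal.ofReal c₂ * Ef ≤ channelEnergy V 0 (-Bs) ψf atTop := by
    calc ENNReal.ofReal c₂ * Ef ≤ ENNReal.ofReal cf * Ef := mul_le_mul' (ENNReal.ofReal_le_ofReal hc₂f) le_rfl
      _ ≤ channelEnergy V 0 (-Bf) ψf atTop := Kf₀ hEft
      _ ≤ channelEnergy V 0 (-Bs) ψf atTop := Parity.channelEnergy_mono_aperture V 0 (by linarith) ψf atTop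
  have Knf : ENNReal.ofReal c₂ * (En + Ef) ≤ knf := by
    calc ENNReal.ofReal c₂ * (En + Ef) = ENNReal.ofReal c₂ * En + ENNReal.ofReal c₂ * Ef := mul_add _ _ _
      _ ≤ channelEnergy V 0 (-Bs) ψn atTop + channelEnergy V 0 (-Bs) ψf atTop := add_le_add Kn Kf
      _ ≤ channelEnergy V 0 (-Bs) (fun t x => ψn t x + ψf t x) atTop := K4a
      _ ≤ knf := Parity.channelEnergy_mono_aperture V 0 (by linarith) _ atTop
  -- pass to real numbers
  have hA' : (0 : ℝ) ≤ 1 + η⁻¹ := hA0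
  have hBq : (0 : ℝ) ≤ 1 + η := by positivity
  have t1 : ENNReal.ofReal (1 + η⁻¹) * kc ≠ ⊤ := ENNReal.mul_ne_top ENNReal.ofReal_ne_top hkct
  have t2 : ENNReal.ofReal (1 + η) * knf ≠ ⊤ := ENNReal.mul_ne_top ENNReal.ofReal_ne_top hknft
  have t3 : ENNReal.ofReal (1 + η⁻¹) * Ec ≠ ⊤ := ENNReal.mul_ne_top ENNReal.ofReal_ne_top hEct
  have t4 : ENNReal.ofReal (1 + η) * (En + Ef) ≠ ⊤ := ENNReal.mul_ne_top ENNReal.ofReal_ne_top hEnft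
  have t5 : ENNReal.ofReal (C₁ * R₁ / B) * Ec ≠ ⊤ := ENNReal.mul_ne_top ENNReal.ofReal_ne_top hEct
  have eK2 := ENNReal.toReal_mono (ENNReal.add_ne_top.2 ⟨ENNReal.add_ne_top.2 ⟨hkt, t3⟩, t4⟩) K2'
  rw [ENNReal.toReal_add (ENNReal.add_ne_top.2 ⟨hEt, t1⟩) t2, ENNReal.toReal_add hEt t1,
    ENNReal.toReal_add (ENNReal.add_ne_top.2 ⟨hkt, t3⟩) t4, ENNReal.toReal_add hkt t3,
    ENNReal.toReal_mul, ENNReal.toReal_mul, ENNReal.toReal_mul, ENNReal.toReal_mul,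
    ENNReal.toReal_ofReal hA', ENNReal.toReal_ofReal hBq] at eK2
  have eK1 := ENNReal.toReal_mono (ENNReal.add_ne_top.2 ⟨hkct, t5⟩) K1'
  rw [ENNReal.toReal_add hkct t5, ENNReal.toReal_mul,
    ENNReal.toReal_ofReal (by positivity : (0 : ℝ) ≤ C₁ * R₁ / B)] at eK1
  have eKnf := ENNReal.toReal_mono hknft Knf
  rw [ENNReal.toReal_mul, ENNReal.toReal_ofReal hc₂0.le] at eKnf
  have eEc := ENNReal.toReal_mono (ENNReal.mul_ne_top ENNReal.ofReal_ne_top hEt) hEc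
  rw [ENNReal.toReal_mul, ENNReal.toReal_ofReal (by norm_num : (0 : ℝ) ≤ 4)] at eEc
  have eEnf := ENNReal.toReal_mono (ENNReal.mul_ne_top ENNReal.ofReal_ne_top hEt) hEnf
  rw [ENNReal.toReal_mul, ENNReal.toReal_ofReal (by positivity : (0 : ℝ) ≤ 1 + δ)] at eEnf
  have e0 : 0 ≤ E.toReal := ENNReal.toReal_nonneg
  have ec0 : 0 ≤ Ec.toReal := ENNReal.toReal_nonneg
  have enf0 : 0 ≤ (En + Ef).toReal := ENNReal.toReal_nonneg
  -- the two linear consequences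
  have h₁ : (1 + η⁻¹) * (C₁ * R₁ / B) * Ec.toReal ≤ c₂ / 8 * E.toReal := by
    calc (1 + η⁻¹) * (C₁ * R₁ / B) * Ec.toReal ≤ (1 + η⁻¹) * (C₁ * R₁ / B) * (4 * E.toReal) :=
          mul_le_mul_of_nonneg_left eEc (by positivity)
      _ = A * (C₁ * R₁ / B) * 4 * E.toReal := by rw [hA]; ring
      _ ≤ c₂ / 8 * E.toReal := mul_le_mul_of_nonneg_right hkey e0
  have h₂ : (1 + η) * ((1 - c₂) * (En + Ef).toReal) ≤ (1 - c₂ / 2) * E.toReal := by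
    calc (1 + η) * ((1 - c₂) * (En + Ef).toReal) ≤ (1 + η) * ((1 - c₂) * ((1 + δ) * E.toReal)) :=
          mul_le_mul_of_nonneg_left (mul_le_mul_of_nonneg_left eEnf (by linarith)) hBq
      _ = (1 + η) * (1 + δ) * (1 - c₂) * E.toReal := by ring
      _ ≤ (1 - c₂ / 2) * E.toReal := mul_le_mul_of_nonneg_right hpoly e0
  have h₃ : (1 + η⁻¹) * Ec.toReal ≤ (1 + η⁻¹) * kc.toReal + (1 + η⁻¹) * (C₁ * R₁ / B) * Ec.toReal := by
    have h := mul_le_mul_of_nonneg_left eK1 hA'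
    have hid : (1 + η⁻¹) * (kc.toReal + C₁ * R₁ / B * Ec.toReal)
        = (1 + η⁻¹) * kc.toReal + (1 + η⁻¹) * (C₁ * R₁ / B) * Ec.toReal := by ring
    linarith [h, hid]
  have h₄ : (1 + η) * (En + Ef).toReal ≤ (1 + η) * knf.toReal + (1 + η) * ((1 - c₂) * (En + Ef).toReal) := by
    have h := mul_le_mul_of_nonneg_left eKnf hBq
    have hid : (1 + η) * (En + Ef).toReal
        = (1 + η) * ((1 - c₂) * (En + Ef).toReal) + (1 + η) * (c₂ * (En + Ef).toReal) := by ring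
    linarith [h, hid]
  have key' : E.toReal - c₂ / 8 * E.toReal - (1 - c₂ / 2) * E.toReal ≤ k.toReal := by
    linarith [eK2, h₁, h₂, h₃, h₄]
  have key : c₂ / 4 * E.toReal ≤ k.toReal := by
    have h5 : E.toReal - c₂ / 8 * E.toReal - (1 - c₂ / 2) * E.toReal = 3 / 8 * (c₂ * E.toReal) := by ring
    have h6 : c₂ / 4 * E.toReal = 1 / 4 * (c₂ * E.toReal) := by ring
    have h7 : 0 ≤ c₂ * E.toReal := mul_nonneg hc₂0.le e0
    rw [h6]
    linarith [key', h5, h7]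
  -- back to `ℝ≥0∞`, and the aperture `ρ − (ρ + B) = −B`
  have keyE : ENNReal.ofReal (c₂ / 4) * E ≤ k := by
    rw [← ENNReal.ofReal_toReal hEt, ← ENNReal.ofReal_mul (by positivity), ← ENNReal.ofReal_toReal hkt]
    exact ENNReal.ofReal_le_ofReal key
  rw [show ρ - (ρ + B) = -B by ring]
  exact keyE

end Summit.FinalStateConjecture.FinalStateConjecture.Theorems.WindowedShellChannelsSketch

end
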